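import Mathlib
import HarnessLib
import Summits.ResolutionOfSingularities.ResolutionOfSingularities.Theorems.WildQuotientsWildQuotientResolutionConductorOneChartAlgebraSCE

/-!
# S2 brick F2″ — unit factors of `u = 1 − s^{p−1}`: `∏_{m=1}^{p−1} (1 + m s) = 1 − s^{p−1}` in characteristic `p`

(crux stmt-ResolutionOfSingularities-15640 `WildQuotients.WildQuotientResolution`, line `Sketch`;
post-V5 rung S2 = `ConductorOneCore p n` — res-L1-w45c-plan-1 NOTE 2026-08-27T17:08:39Z («∏_{i∈𝔽_p}(1 + i s) = u»,
«σ̃ restricts to an AUTOMORPHISM of M₀ = k[s,c,e][1/u]») and 17:37:59Z (b)(ii) («`…ConductorOneUnitFactors.lean`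
… needed by F5a's σ̃^m restricts to M₀ either way»); res-L1-w45c-lead-1 g5 F5a consumer. [OURS · L1 W4.5c] —
NOT a statement of any manuscript; replaces the role of no printed item. Mathlib + F2′ only; def-free.
Prover res-L1-w45c-stub-3.)

* `prod_one_add_C_mul_X` — in `(ZMod p)[X]`: `∏_{m=1}^{p−1} (1 + m X) = 1 − X^{p−1}` (both sides have degree
  `< p` and agree at every point of `𝔽_p`: at `b = 0` both are `1`, at `b ≠ 0` the factor `m = −b⁻¹` kills
  the left side and Fermat kills the right side);
* `prod_one_add_natCast_mul` — in any commutative ring `S` of characteristic `p`: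
  `∏_{m=1}^{p−1} (1 + m s) = 1 − s^{p−1}`;
* `one_add_natCast_mul_witness` — hence an inverse witness `v` of `u = 1 − s^{p−1}` yields inverse witnesses
  of every `1 + m s`, `1 ≤ m < p`;
* `iterate_s_eq`, `iterate_c_eq` — with F2′'s unit-free iterate laws: `σ^m s = s · (1 + m s)⁻¹`,
  `σ^m c_k = c_k · (1 + m s)⁻¹` in witness form (so `σ^m` maps `M₀ = k[s, c, e][1/u]` into itself).
-/

-- single-problem summit: the doubled namespace component `ResolutionOfSingularities` is forced
set_option linter.dupNamespace false

noncomputable section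

open Polynomial

namespace Summit.ResolutionOfSingularities.ResolutionOfSingularities.Theorems.WildQuotientResolution.ConductorOne

/-- **`∏_{m=1}^{p−1} (1 + m X) = 1 − X^{p−1}` in `𝔽_p[X]`.** [folklore; Lagrange 1771 / Wilson-type identity] -/
theorem prod_one_add_C_mul_X (p : ℕ) [hp : Fact p.Prime] :
    (∏ m ∈ Finset.Ico 1 p, (1 + C ((m : ℕ) : ZMod p) * X) : (ZMod p)[X]) = 1 - X ^ (p - 1) := by
  have hp1 : 1 ≤ p := hp.out.one_le
  -- degrees
  have hdegL : (∏ m ∈ Finset.Ico 1 p, (1 + C ((m : ℕ) : ZMod p) * X) : (ZMod p)[X]).natDegree ≤ p - 1 := by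
    refine (natDegree_prod_le _ _).trans ?_
    calc ∑ m ∈ Finset.Ico 1 p, (1 + C ((m : ℕ) : ZMod p) * X : (ZMod p)[X]).natDegree
        ≤ ∑ _m ∈ Finset.Ico 1 p, 1 := Finset.sum_le_sum fun m _ => by
          refine (natDegree_add_le _ _).trans ?_
          rw [natDegree_one, Nat.zero_max]
          exact (natDegree_C_mul_le _ _).trans natDegree_X_le
      _ = p - 1 := by simp
  have hdegR : (1 - X ^ (p - 1) : (ZMod p)[X]).natDegree ≤ p - 1 := by
    refine (natDegree_sub_le _ _).trans ?_
    rw [natDegree_one, natDegree_X_pow, Nat.zero_max]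
  -- the difference vanishes at every point of `𝔽_p`
  apply sub_eq_zero.mp
  refine Polynomial.eq_zero_of_natDegree_lt_card_of_eval_eq_zero _ (f := (id : ZMod p → ZMod p))
    Function.injective_id ?_ ?_
  · intro b
    rw [id, eval_sub, eval_prod, eval_sub, eval_one, eval_pow, eval_X]
    simp only [eval_add, eval_one, eval_mul, eval_C, eval_X]
    by_cases hb : b = 0
    · rw [hb, zero_pow (Nat.sub_ne_zero_of_lt hp.out.one_lt), sub_zero]
      simp
    · -- the factor `m = val (−b⁻¹)` vanishes; Fermat on the right
      have hfermat : b ^ (p - 1) = 1 := ZMod.pow_card_sub_one_eq_one hb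
      rw [hfermat, sub_self, sub_zero]
      apply Finset.prod_eq_zero (i := ((-b⁻¹ : ZMod p).val))
      · rw [Finset.mem_Ico]
        refine ⟨Nat.one_le_iff_ne_zero.mpr ?_, ZMod.val_lt _⟩
        rw [ne_eq, ZMod.val_eq_zero, neg_eq_zero]
        exact inv_ne_zero hb
      · rw [ZMod.natCast_zmod_val, neg_mul, inv_mul_cancel₀ hb, add_neg_cancel]
  · calc (∏ m ∈ Finset.Ico 1 p, (1 + C ((m : ℕ) : ZMod p) * X) - (1 - X ^ (p - 1)) : (ZMod p)[X]).natDegree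
        ≤ p - 1 := (natDegree_sub_le _ _).trans (max_le hdegL hdegR)
      _ < Fintype.card (ZMod p) := by rw [ZMod.card]; exact Nat.sub_lt hp1 Nat.one_pos

/-- **`∏_{m=1}^{p−1} (1 + m s) = 1 − s^{p−1}`** in any commutative ring of characteristic `p`. [folklore] -/
theorem prod_one_add_natCast_mul (S : Type*) [CommRing S] (p : ℕ) [Fact p.Prime] [CharP S p] (s : S) :
    ∏ m ∈ Finset.Ico 1 p, (1 + (m : S) * s) = 1 - s ^ (p - 1) := by
  have h := congrArg (Polynomial.eval₂ (ZMod.castHom (dvd_refl p) S) s) (prod_one_add_C_mul_X p)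
  rw [eval₂_finsetProd, eval₂_sub, eval₂_one, eval₂_pow, eval₂_X] at h
  simp only [eval₂_add, eval₂_one, eval₂_mul, eval₂_C, eval₂_X] at h
  simp only [map_natCast] at h
  exact h

/-- **Inverse witnesses of the factors**: if `(1 − s^{p−1}) v = 1` then for `1 ≤ m < p`
`(1 + m s) · ((∏_{m' ≠ m} (1 + m' s)) · v) = 1`. [folklore] -/
theorem one_add_natCast_mul_witness (S : Type*) [CommRing S] (p : ℕ) [Fact p.Prime] [CharP S p] (s : S)
    (v : S) (hv : (1 - s ^ (p - 1)) * v = 1) (m : ℕ) (hm : m ∈ Finset.Ico 1 p) :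
    (1 + (m : S) * s) * ((∏ m' ∈ (Finset.Ico 1 p).erase m, (1 + (m' : S) * s)) * v) = 1 := by
  have key : (1 + (m : S) * s) * ∏ m' ∈ (Finset.Ico 1 p).erase m, (1 + (m' : S) * s)
      = ∏ m' ∈ Finset.Ico 1 p, (1 + (m' : S) * s) :=
    Finset.mul_prod_erase (Finset.Ico 1 p) (fun m' => (1 : S) + (m' : S) * s) hm
  rw [← mul_assoc, key, prod_one_add_natCast_mul, hv]

variable {M : Type} [CommRing M] (σ : M →+* M) (s : M) (hs : σ s * (1 + s) = s)

include hs in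
/-- **`σ^m s = s · (1 + m s)⁻¹` in witness form**: `σ^[m] s = s · ((∏_{m' ≠ m} (1 + m' s)) · v)` for
`1 ≤ m < p` (F2′ `iterate_law_s` + `one_add_natCast_mul_witness`); in particular `σ^m s ∈ k[s][1/u]`.
[OURS · L1 W4.5c] -/
theorem iterate_s_eq (p : ℕ) [Fact p.Prime] [CharP M p] (v : M) (hv : (1 - s ^ (p - 1)) * v = 1)
    (m : ℕ) (hm : m ∈ Finset.Ico 1 p) :
    σ^[m] s = s * ((∏ m' ∈ (Finset.Ico 1 p).erase m, (1 + (m' : M) * s)) * v) := by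
  have h1 := iterate_law_s σ s hs m
  have h2 := one_add_natCast_mul_witness M p s v hv m hm
  calc σ^[m] s = σ^[m] s * ((1 + (m : M) * s) * ((∏ m' ∈ (Finset.Ico 1 p).erase m,
        (1 + (m' : M) * s)) * v)) := by rw [h2, mul_one]
    _ = s * ((∏ m' ∈ (Finset.Ico 1 p).erase m, (1 + (m' : M) * s)) * v) := by
        rw [← mul_assoc, h1]

variable {κ : Type} (c : κ → M) (hc : ∀ k, σ (c k) * (1 + s) = c k)

include hs hc in
/-- **`σ^m c_k = c_k · (1 + m s)⁻¹` in witness form** (F2′ `iterate_law_c`). [OURS · L1 W4.5c] -/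
theorem iterate_c_eq (p : ℕ) [Fact p.Prime] [CharP M p] (v : M) (hv : (1 - s ^ (p - 1)) * v = 1)
    (k : κ) (m : ℕ) (hm : m ∈ Finset.Ico 1 p) :
    σ^[m] (c k) = c k * ((∏ m' ∈ (Finset.Ico 1 p).erase m, (1 + (m' : M) * s)) * v) := by
  have h1 := iterate_law_c σ s hs c hc k m
  have h2 := one_add_natCast_mul_witness M p s v hv m hm
  calc σ^[m] (c k) = σ^[m] (c k) * ((1 + (m : M) * s) * ((∏ m' ∈ (Finset.Ico 1 p).erase m,
        (1 + (m' : M) * s)) * v)) := by rw [h2, mul_one]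
    _ = c k * ((∏ m' ∈ (Finset.Ico 1 p).erase m, (1 + (m' : M) * s)) * v) := by
        rw [← mul_assoc, h1]

end Summit.ResolutionOfSingularities.ResolutionOfSingularities.Theorems.WildQuotientResolution.ConductorOne

end
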